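import Summits.BirchSwinnertonDyer.BirchSwinnertonDyer.Theorems.KatoDescentPotSupersingularASideJunction
import Mathlib.NumberTheory.Padics.PadicIntegers
import Mathlib.Data.Nat.Factorization.Basic
import HarnessLib

/-!
# The hypothesis `p^N A ⊆ ℤ_p y₀` of crux M's A-side ledger from the finite index `[A : ℤ_p y₀] ≠ 0` (Kato Thm. 14.5 (2), the `index_ne_zero` clause):
# `N = v_p [A : ℤ_p y₀]`, the prime-to-`p` part of the index being a unit of `ℤ_p`
# (route `KatoDescentPotSupersingular` / `…Tame…`, crux M = stmt-BirchSwinnertonDyer-19196; route-free helper)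

Seat `bsd-potss-rkm` g20 (prover; cell `bsd-potss`), item stmt-BirchSwinnertonDyer-19196 (`--supports … --as helper`; closes nothing).
HONEST FRAMING: BSD is not proved by any of this; nothing is booked; theorems only (no definition, no named fact).  Pure `ℤ_p`-algebra.

## What

Parts 49–56 carry `hN : ∀ a ∈ A, p^N • a ∈ ℤ_p y₀`.  The held package `Kato2004.MemberHullZetaInputs` states Thm. 14.5 (2) as `index_ne_zero`:
`#(A ⧸ Λ·ι(ȳ)) ≠ 0`, i.e. `[A : ℤ_p y₀] ≠ 0`.  Part 47 (`ASideJunction.index_smul_mem_span_singleton`) gives `[A : ℤ_p y₀] • A ⊆ ℤ_p y₀`; writing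
`[A : ℤ_p y₀] = p^N · u` with `p ∤ u`, `u` is a unit of `ℤ_p` (`PadicInt.norm_natCast_eq_one_iff`) and `ℤ_p y₀` is a `ℤ_p`-submodule, so `p^N • A ⊆ ℤ_p y₀`:

* `pow_padicValNat_smul_mem_span_singleton` — `∀ a ∈ A, (p^{v_p [A : ℤ_p y₀]} : ℤ) • a ∈ ℤ_p y₀` whenever `[A : ℤ_p y₀] ≠ 0`;
* `exists_pow_smul_mem_span_singleton_of_relIndex_ne_zero` — `∃ N, ∀ a ∈ A, (p^N : ℤ) • a ∈ ℤ_p y₀` (the shape of `hN`).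

References: K. Kato, Astérisque 295 (2004), Thm. 14.5 (2) (p. 236), proof of Prop. 14.16 (2) (pp. 244–245) [Kato2004Asterisque]; J.-P. Serre,
*Local Fields*, Ch. I §3 [SerreLocalFields1979].
-/

-- the summit and its single problem are both named `BirchSwinnertonDyer` (registry layout D-0017)
set_option linter.dupNamespace false
set_option autoImplicit false

namespace Summit.BirchSwinnertonDyer.BirchSwinnertonDyer.Theorems.ASideJunction

section Index

variable {p : ℕ} [hp : Fact p.Prime] {M : Type*} [AddCommGroup M] [Module ℤ_[p] M]

/-- **`p^{v_p [A : ℤ_p y₀]} • A ⊆ ℤ_p y₀` when `[A : ℤ_p y₀] ≠ 0`**: `[A : ℤ_p y₀] = p^N·u` with `p ∤ u`, `[A : ℤ_p y₀] • a ∈ ℤ_p y₀` (part 47), and `u` is a unit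
of `ℤ_p`. [cite: Kato2004Asterisque, Thm. 14.5 (2) (p. 236) and proof of Prop. 14.16 (2) (pp. 244–245)] [cite: SerreLocalFields1979, Ch. I §3] -/
theorem pow_padicValNat_smul_mem_span_singleton (A : Submodule ℤ_[p] M) (y₀ : M) (hy₀ : y₀ ∈ A)
    (hidx : (ℤ_[p] ∙ y₀).toAddSubgroup.relIndex A.toAddSubgroup ≠ 0) (a : M) (ha : a ∈ A) :
    ((p ^ padicValNat p ((ℤ_[p] ∙ y₀).toAddSubgroup.relIndex A.toAddSubgroup) : ℕ) : ℤ) • a ∈ (ℤ_[p] ∙ y₀).toAddSubgroup := by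
  set n := (ℤ_[p] ∙ y₀).toAddSubgroup.relIndex A.toAddSubgroup with hn
  obtain ⟨N, u, hu, hnu⟩ := Nat.exists_eq_pow_mul_and_not_dvd hidx p hp.out.ne_one
  have hN : padicValNat p n = N := by
    have hu0 : u ≠ 0 := fun h => hu (h ▸ dvd_zero p)
    rw [hnu, padicValNat.mul (pow_ne_zero N hp.out.ne_zero) hu0, padicValNat.prime_pow, padicValNat.eq_zero_of_not_dvd hu, add_zero]
  rw [hN]
  -- `n • a ∈ ℤ_p y₀`
  have hna : (n : ℤ) • a ∈ (ℤ_[p] ∙ y₀).toAddSubgroup := index_smul_mem_span_singleton A y₀ hy₀ a ha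
  -- `u` is a unit of `ℤ_p`
  have hunit : IsUnit (u : ℤ_[p]) := by
    rw [PadicInt.isUnit_iff, PadicInt.norm_natCast_eq_one_iff]
    exact (hp.out.coprime_iff_not_dvd).mpr hu
  obtain ⟨v, hv⟩ := hunit
  -- `p^N • a = u⁻¹ • (n • a)`
  rw [Submodule.mem_toAddSubgroup] at hna ⊢
  have key : ((p ^ N : ℕ) : ℤ) • a = ((v⁻¹ : ℤ_[p]ˣ) : ℤ_[p]) • ((n : ℤ) • a) := by
    rw [← Int.cast_smul_eq_zsmul ℤ_[p] (n : ℤ), ← Int.cast_smul_eq_zsmul ℤ_[p] ((p ^ N : ℕ) : ℤ), smul_smul, Int.cast_natCast,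
      Int.cast_natCast, hnu, Nat.cast_mul, ← hv, ← mul_assoc, mul_comm ((v⁻¹ : ℤ_[p]ˣ) : ℤ_[p]), mul_assoc, Units.inv_mul, mul_one]
  rw [key]
  exact Submodule.smul_mem _ _ hna

/-- **`∃ N, p^N • A ⊆ ℤ_p y₀` from `[A : ℤ_p y₀] ≠ 0`** — the hypothesis `hN` of `KatoFiniteLevelCount.exists_forall_aSide_le` and parts 50–56, from the
`index_ne_zero` clause (Kato Thm. 14.5 (2)) at Kato's `A = H¹(ℤ[1/p],T_pW)`. [cite: Kato2004Asterisque, Thm. 14.5 (2) (p. 236)] -/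
theorem exists_pow_smul_mem_span_singleton_of_relIndex_ne_zero (A : Submodule ℤ_[p] M) (y₀ : M) (hy₀ : y₀ ∈ A)
    (hidx : (ℤ_[p] ∙ y₀).toAddSubgroup.relIndex A.toAddSubgroup ≠ 0) :
    ∃ N : ℕ, ∀ a ∈ A, ((p ^ N : ℕ) : ℤ) • a ∈ (ℤ_[p] ∙ y₀).toAddSubgroup :=
  ⟨_, fun a ha => pow_padicValNat_smul_mem_span_singleton A y₀ hy₀ hidx a ha⟩

end Index

end Summit.BirchSwinnertonDyer.BirchSwinnertonDyer.Theorems.ASideJunction
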